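import Literature.NumberTheory.IwasawaTheory.ClassNumberPExpZeroCyclotomicFour
import Literature.NumberTheory.NumberFields.CMQuadraticExtension
import Literature.NumberTheory.IwasawaTheory.ClassicalLambdaInvariant
import Mathlib.FieldTheory.IsAlgClosed.AlgebraicClosure
import HarnessLib

/-!
# The model `ℚ⟮i⟯ ⊆ ℚ̄` (`i² = −1`): degree `2`, Galois, a fourth cyclotomic extension, and `e_n = 0` for every `ℤ₂`-extension (Weber)
# (proved; no definition, no named fact)

`Proofs`-style file (theorems only, no `sorry`) in topic `NumberTheory/IwasawaTheory` (namespace `Literature.NumberTheory.IwasawaTheory`), written by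
the prover seat `bsd-line-att-p3` g35 (cell `bsd-f1-sign2`; `--supports` stmt-BirchSwinnertonDyer-22298; closes nothing; nothing about elliptic curves
or BSD is asserted).  Small bookkeeping for the subfield `ℚ⟮i⟯` of `ℚ̄` generated by a square root `i` of `−1` — the base of Iwasawa's 1973 §4 route
and the quadratic «base» of the `S₃`-pair of `ℚ(W[2], i)` (cell bsd-f1-sign2, crux C2): `[ℚ(i) : ℚ] = 2`, `ℚ(i)/ℚ` Galois, `i` is a primitive `4`-th
root of unity so `ℚ⟮i⟯` is a `{4}`-cyclotomic extension of `ℚ` (Mathlib `IsPrimitiveRoot.adjoin_isCyclotomicExtension`, transported from `Algebra.adjoin`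
to `IntermediateField.adjoin`), hence the tree theorem `classNumberPExp_eq_zero_of_isCyclotomicExtension_four` (Iwasawa 1956 on `ℚ(ζ₄)`: `h = 1`, one
prime above `2`; i.e. `2 ∤ h(ℚ(ζ_{2^{n+2}}))`, Weber) gives **`e_n(κ) = 0` for every `ℤ₂`-extension `κ` of `ℚ⟮i⟯` and every `n`**.

* `finrank_adjoin_sqrt_neg_one`, `isGalois_adjoin_sqrt_neg_one`, `isPrimitiveRoot_four_of_sq_eq_neg_one`, `isCyclotomicExtension_four_adjoin_sqrt_neg_one`,
  ★ `classNumberPExp_adjoin_sqrt_neg_one_eq_zero`, `classicalMuVanishes_adjoin_sqrt_neg_one_of_any` (growth form with `λ = 0`).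

References: [Washington1997] §13.1, Prop. 13.22, Thm. 10.4 (Weber); [Greenberg2001IwasawaPastPresent] Prop. 2.1.
-/

set_option autoImplicit false

noncomputable section

open scoped NumberField Classical IntermediateField
open NumberField Field IntermediateField Polynomial

namespace Literature.NumberTheory.IwasawaTheory

open Literature.NumberTheory.EllipticCurves Literature.NumberTheory.NumberFields

/-- **`[ℚ(i) : ℚ] = 2`** for `i² = −1` (model `ℚ⟮i⟯ ⊆ ℚ̄`). [cite: Washington1997, §13.1] -/
theorem finrank_adjoin_sqrt_neg_one {i : AlgebraicClosure ℚ} (hi : i ^ 2 = -1) :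
    Module.finrank ℚ ↥(IntermediateField.adjoin ℚ ({i} : Set (AlgebraicClosure ℚ))) = 2 := by
  have hiQ : i ∉ Set.range (algebraMap ℚ (AlgebraicClosure ℚ)) := by
    rintro ⟨q, hq⟩
    have h1 : (algebraMap ℚ (AlgebraicClosure ℚ)) (q ^ 2) = algebraMap ℚ (AlgebraicClosure ℚ) (-1) := by
      rw [map_pow, hq, hi, map_neg, map_one]
    have h2 : q ^ 2 = -1 := (algebraMap ℚ (AlgebraicClosure ℚ)).injective h1
    nlinarith [sq_nonneg q]
  exact finrank_adjoin_simple_eq_two_of_sq_eq (a := (-1 : ℚ)) (by rw [hi, map_neg, map_one]) hiQ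

/-- `ℚ⟮i⟯/ℚ` is Galois (quadratic). [cite: Washington1997, §13.1] -/
theorem isGalois_adjoin_sqrt_neg_one {i : AlgebraicClosure ℚ} (hi : i ^ 2 = -1) :
    IsGalois ℚ ↥(IntermediateField.adjoin ℚ ({i} : Set (AlgebraicClosure ℚ))) := by
  haveI : Algebra.IsQuadraticExtension ℚ ↥(IntermediateField.adjoin ℚ ({i} : Set (AlgebraicClosure ℚ))) :=
    ⟨finrank_adjoin_sqrt_neg_one hi⟩
  infer_instance

/-- `i` with `i² = −1` is a primitive `4`-th root of unity. [cite: Washington1997, §2 (roots of unity; ζ₄ = √−1)] -/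
theorem isPrimitiveRoot_four_of_sq_eq_neg_one {i : AlgebraicClosure ℚ} (hi : i ^ 2 = -1) : IsPrimitiveRoot i 4 := by
  have hi4 : i ^ 4 = 1 := by
    rw [show (4 : ℕ) = 2 * 2 from rfl, pow_mul, hi]
    norm_num
  refine (IsPrimitiveRoot.iff_def i 4).mpr ⟨hi4, fun l hl ↦ ?_⟩
  have hr : i ^ (l % 4) = 1 := by
    rw [← Nat.div_add_mod l 4, pow_add, pow_mul, hi4, one_pow, one_mul] at hl
    exact hl
  have h1 : i ≠ 1 := by
    intro h
    rw [h] at hi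
    norm_num at hi
  have hlt : l % 4 < 4 := Nat.mod_lt _ (by norm_num)
  interval_cases hm : l % 4
  · exact Nat.dvd_of_mod_eq_zero hm
  · rw [pow_one] at hr
    exact absurd hr h1
  · rw [hi] at hr
    norm_num at hr
  · exfalso
    apply h1
    have : i ^ 4 = i ^ 3 * i := by ring
    rw [hi4, hr, one_mul] at this
    exact this.symm

/-- `ℚ⟮i⟯ ⊆ ℚ̄` is a fourth cyclotomic extension of `ℚ`. [cite: Washington1997, §2] -/
theorem isCyclotomicExtension_four_adjoin_sqrt_neg_one {i : AlgebraicClosure ℚ} (hi : i ^ 2 = -1) :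
    IsCyclotomicExtension {4} ℚ ↥(IntermediateField.adjoin ℚ ({i} : Set (AlgebraicClosure ℚ))) := by
  haveI : NeZero (4 : ℕ) := ⟨by norm_num⟩
  have hprim := isPrimitiveRoot_four_of_sq_eq_neg_one hi
  haveI h0 : IsCyclotomicExtension {4} ℚ ↥(Algebra.adjoin ℚ ({i} : Set (AlgebraicClosure ℚ))) :=
    hprim.adjoin_isCyclotomicExtension ℚ
  have hint : IsIntegral ℚ i := by
    refine ⟨X ^ 2 + 1, monic_X_pow_add_C _ two_ne_zero, ?_⟩
    simp [hi]
  have heq : Algebra.adjoin ℚ ({i} : Set (AlgebraicClosure ℚ)) =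
      (IntermediateField.adjoin ℚ ({i} : Set (AlgebraicClosure ℚ))).toSubalgebra :=
    (IntermediateField.adjoin_simple_toSubalgebra_of_isAlgebraic hint.isAlgebraic).symm
  exact IsCyclotomicExtension.equiv {4} ℚ ↥(Algebra.adjoin ℚ ({i} : Set (AlgebraicClosure ℚ))) (Subalgebra.equivOfEq _ _ heq)

/-- **`e_n(ℚ(i)) = 0` for every `ℤ₂`-extension of `ℚ⟮i⟯`** (`2 ∤ h(ℚ(ζ_{2^{n+2}}))`, Weber; tree `classNumberPExp_eq_zero_of_isCyclotomicExtension_four`).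
[cite: Washington1997, Prop. 13.22 and Thm. 10.4] [cite: Greenberg2001IwasawaPastPresent, Prop. 2.1] -/
theorem classNumberPExp_adjoin_sqrt_neg_one_eq_zero {i : AlgebraicClosure ℚ} (hi : i ^ 2 = -1)
    [NumberField ↥(IntermediateField.adjoin ℚ ({i} : Set (AlgebraicClosure ℚ)))]
    (κQ : ZpExtension ↥(IntermediateField.adjoin ℚ ({i} : Set (AlgebraicClosure ℚ))) 2) (n : ℕ) : classNumberPExp κQ n = 0 := by
  haveI : Fact (Nat.Prime 2) := ⟨Nat.prime_two⟩
  haveI : IsCyclotomicExtension {2 ^ 2} ℚ ↥(IntermediateField.adjoin ℚ ({i} : Set (AlgebraicClosure ℚ))) := by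
    have h := isCyclotomicExtension_four_adjoin_sqrt_neg_one hi
    norm_num
    exact h
  exact classNumberPExp_eq_zero_of_isCyclotomicExtension_four _ κQ n

/-- **Growth form with `λ = μ = ν = 0` for every `ℤ₂`-extension of `ℚ⟮i⟯`** (`e_n = 0 = 0·n + 0`). [cite: Washington1997, Prop. 13.22] -/
theorem classicalMuVanishes_adjoin_sqrt_neg_one_of_any {i : AlgebraicClosure ℚ} (hi : i ^ 2 = -1)
    [NumberField ↥(IntermediateField.adjoin ℚ ({i} : Set (AlgebraicClosure ℚ)))]
    (κQ : ZpExtension ↥(IntermediateField.adjoin ℚ ({i} : Set (AlgebraicClosure ℚ))) 2) :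
    ClassicalMuVanishes κQ ∧ classicalLambda κQ = 0 := by
  have hg : ∀ n, 0 ≤ n → (classNumberPExp κQ n : ℤ) = ((0 : ℕ) : ℤ) * n + 0 := by
    intro n _
    rw [classNumberPExp_adjoin_sqrt_neg_one_eq_zero hi κQ n]
    simp
  have hμ : ClassicalMuVanishes κQ := ⟨0, 0, 0, hg⟩
  exact ⟨hμ, (eq_classicalLambda_of_growth κQ hg).symm⟩

end Literature.NumberTheory.IwasawaTheory

end
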